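import Literature.Barriers.CriticalPhenomena.WeaklySAWFourDimLogCorrectionsProofs
import Mathlib.MeasureTheory.Constructions.Pi
import Mathlib.MeasureTheory.Integral.Pi
import Mathlib.Analysis.SpecialFunctions.Integrals.Basic
import HarnessLib

/-!
# Sojourn simplices of the continuous-time walk: volumes and moments

Support file for the discharge of `Literature.Barriers.CriticalPhenomena.CTWSAW.BBS2015_lemA1`
(Bauerschmidt–Brydges–Slade 2015, Lemma A.1) in the jump-chain representation of
`WeaklySAWFourDimLogCorrections.lean`: the admissible inter-jump durations
`sojournSet k T = {s : ℝ^k | s > 0, Σ s < T}` (a simplex) and the sojourn times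
`sojourns T s = (s₀, …, s_{k-1}, T - Σ s)`.

Builds on `WeaklySAWFourDimLogCorrectionsProofs.lean` (`measurableSet_sojournSet`,
`sojournSet_eq_empty_of_nonpos`, `sojourns_pos`, `volume_sojournSet : |Δ_n(u)| = uⁿ/n!`).

PROVED here (Lebesgue measure on `ℝ^k`):
* `isOpen_sojournSet`;
* the peeling identity `lintegral_sojournSet_succ`: integrating out one coordinate `i`,
  `∫_{Δ_{n+1}(u)} F = ∫_{t ∈ (0,u)} ∫_{Δ_n(u-t)} F(insertNth i t s') ds' dt`, together with
  `sojourns_insertNth` (the sojourn vector of the peeled configuration);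
* `lintegral_Ioi_lintegral_sojournSet`: `∫_{T>0}∫_{Δ_n(T)} H(sojourns T s) ds dT = ∫_{(0,∞)^{n+1}} H`
  (unit Jacobian of `(T,s) ↦ (s, T - Σ s)`), and `setLIntegral_pi_Ioi_prod_eq_pow`;
* `lintegral_sojourns`: `∫_{Δ_n(u)} σ_a ds = u^{n+1}/(n+1)!` for every sojourn `σ_a`, `a ≤ n`
  (including the terminal one);
* `lintegral_sojourns_mul_sojourns`: `∫_{Δ_n(u)} σ_a σ_b ds = (1 + [a = b]) u^{n+2}/(n+2)!`.
These are the Dirichlet moments behind "`E(I(T) | S_{T,n}) = 2T²/(n+2)`" in the printed proof of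
Lemma A.1 [BBS2015, (A.8)–(A.9)], obtained here by Fubini rather than by order statistics.

## References
* R. Bauerschmidt, D. C. Brydges, G. Slade, *Logarithmic correction for the susceptibility of
  the 4-dimensional weakly self-avoiding walk: a renormalisation group analysis*, CMP 337 (2015),
  Appendix A, Lemma A.1. [BauerschmidtBrydgesSlade2015LogCorr]
-/

noncomputable section

open MeasureTheory Set Filter
open scoped ENNReal BigOperators Nat

namespace Literature.Barriers.CriticalPhenomena.CTWSAW

/-! ### The simplex `sojournSet` -/

/-- The simplex of admissible durations is an open, hence measurable, set. [folklore] -/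
theorem isOpen_sojournSet (k : ℕ) (T : ℝ) : IsOpen (sojournSet k T) := by
  have h1 : IsOpen {s : Fin k → ℝ | ∀ i, 0 < s i} := by
    rw [show {s : Fin k → ℝ | ∀ i, 0 < s i} = ⋂ i, {s | 0 < s i} by ext; simp]
    exact isOpen_iInter_of_finite fun i => isOpen_lt continuous_const (continuous_apply i)
  have h2 : IsOpen {s : Fin k → ℝ | ∑ i, s i < T} :=
    isOpen_lt (continuous_finsetSum _ fun i _ => continuous_apply i) continuous_const
  simpa [sojournSet, Set.setOf_and] using h1.inter h2

/-- Membership in the simplex, unfolded. [folklore] -/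
theorem mem_sojournSet {k : ℕ} {T : ℝ} {s : Fin k → ℝ} :
    s ∈ sojournSet k T ↔ (∀ i, 0 < s i) ∧ ∑ i, s i < T := Iff.rfl

/-- On the simplex the total duration is nonnegative. [folklore] -/
theorem sum_nonneg_of_mem_sojournSet {k : ℕ} {T : ℝ} {s : Fin k → ℝ} (hs : s ∈ sojournSet k T) :
    0 ≤ ∑ i, s i :=
  Finset.sum_nonneg fun i _ => (hs.1 i).le

/-- A point of the simplex forces `T > 0`. [folklore] -/
theorem pos_of_mem_sojournSet {k : ℕ} {T : ℝ} {s : Fin k → ℝ} (hs : s ∈ sojournSet k T) : 0 < T :=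
  (sum_nonneg_of_mem_sojournSet hs).trans_lt hs.2

/-- In dimension `0` the simplex is everything (for `T > 0`). [folklore] -/
theorem sojournSet_zero_of_pos {T : ℝ} (hT : 0 < T) : sojournSet 0 T = univ := by
  rw [sojournSet_zero, if_pos hT]

/-! ### Sojourn times -/

/-- The inner sojourns are the durations themselves. [folklore] -/
@[simp] theorem sojourns_castSucc (T : ℝ) {k : ℕ} (s : Fin k → ℝ) (i : Fin k) :
    sojourns T s i.castSucc = s i := by
  simp [sojourns]

/-- The terminal sojourn lasts `T - Σ s`. [folklore] -/
@[simp] theorem sojourns_last (T : ℝ) {k : ℕ} (s : Fin k → ℝ) :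
    sojourns T s (Fin.last k) = T - ∑ i, s i := by
  simp [sojourns]

/-- All sojourns are nonnegative on the simplex. [folklore] -/
theorem sojourns_nonneg {k : ℕ} {T : ℝ} {s : Fin k → ℝ} (hs : s ∈ sojournSet k T) (a : Fin (k + 1)) :
    0 ≤ sojourns T s a :=
  (sojourns_pos hs a).le

/-- The sojourns sum to the total time `T`. [folklore] -/
theorem sum_sojourns (T : ℝ) {k : ℕ} (s : Fin k → ℝ) : ∑ a, sojourns T s a = T := by
  rw [Fin.sum_univ_castSucc]
  simp

/-- Each sojourn is at most `T` on the simplex. [folklore] -/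
theorem sojourns_le {k : ℕ} {T : ℝ} {s : Fin k → ℝ} (hs : s ∈ sojournSet k T) (a : Fin (k + 1)) :
    sojourns T s a ≤ T := by
  calc sojourns T s a ≤ ∑ b, sojourns T s b :=
        Finset.single_le_sum (fun b _ => sojourns_nonneg hs b) (Finset.mem_univ a)
    _ = T := sum_sojourns T s

/-- `sojourns` is continuous (hence measurable) in the durations. [folklore] -/
@[fun_prop]
theorem continuous_sojourns (T : ℝ) (k : ℕ) (a : Fin (k + 1)) :
    Continuous fun s : Fin k → ℝ => sojourns T s a := by
  induction a using Fin.lastCases with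
  | last =>
    simp only [sojourns_last]
    exact continuous_const.sub (continuous_finsetSum _ fun i _ => continuous_apply i)
  | cast i => simp only [sojourns_castSucc]; exact continuous_apply i

/-- `sojourns` is measurable in the durations. [folklore] -/
@[fun_prop]
theorem measurable_sojourns (T : ℝ) (k : ℕ) (a : Fin (k + 1)) :
    Measurable fun s : Fin k → ℝ => sojourns T s a :=
  (continuous_sojourns T k a).measurable

/-! ### Peeling one coordinate -/

/-- Inserting a duration `t` at position `i` into `s' ∈ ℝⁿ`: the total is `t + Σ s'`. [folklore] -/
theorem sum_insertNth {n : ℕ} (i : Fin (n + 1)) (t : ℝ) (s' : Fin n → ℝ) :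
    ∑ j, i.insertNth t s' j = t + ∑ j, s' j := by
  rw [Fin.sum_univ_succAbove _ i, Fin.insertNth_apply_same]
  simp [Fin.insertNth_apply_succAbove]

/-- Membership of a peeled configuration in the simplex. [folklore] -/
theorem insertNth_mem_sojournSet_iff {n : ℕ} (i : Fin (n + 1)) (t u : ℝ) (s' : Fin n → ℝ) :
    i.insertNth t s' ∈ sojournSet (n + 1) u ↔ t ∈ Ioo 0 u ∧ s' ∈ sojournSet n (u - t) := by
  rw [mem_sojournSet, mem_sojournSet, sum_insertNth, Fin.forall_iff_succAbove i,
    Fin.insertNth_apply_same]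
  simp only [Fin.insertNth_apply_succAbove, mem_Ioo]
  constructor
  · rintro ⟨⟨ht, hs⟩, hsum⟩
    have h0 : 0 ≤ ∑ j, s' j := Finset.sum_nonneg fun j _ => (hs j).le
    exact ⟨⟨ht, by linarith⟩, hs, by linarith⟩
  · rintro ⟨⟨ht, -⟩, hs, hsum⟩
    exact ⟨⟨ht, hs⟩, by linarith⟩

/-- **The sojourn vector of a peeled configuration**: inserting the duration `t` at position `i`
inserts the sojourn `t` at position `i` of the sojourn vector of the remaining configuration,
run for the remaining time `u - t`. [folklore] -/
theorem sojourns_insertNth {n : ℕ} (i : Fin (n + 1)) (t u : ℝ) (s' : Fin n → ℝ) :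
    sojourns u (i.insertNth t s') = (Fin.castSucc i).insertNth t (sojourns (u - t) s') := by
  symm
  rw [Fin.insertNth_eq_iff]
  constructor
  · rw [sojourns_castSucc, Fin.insertNth_apply_same]
  · funext a
    simp only [Fin.removeNth]
    induction a using Fin.lastCases with
    | last =>
      rw [Fin.succAbove_ne_last_last (Fin.castSucc_lt_last i).ne, sojourns_last, sojourns_last,
        sum_insertNth]
      ring
    | cast j =>
      rw [Fin.castSucc_succAbove_castSucc, sojourns_castSucc, sojourns_castSucc,
        Fin.insertNth_apply_succAbove]

/-- The terminal sojourn of a peeled configuration is the terminal sojourn of the rest. [folklore] -/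
theorem sojourns_insertNth_last {n : ℕ} (i : Fin (n + 1)) (t u : ℝ) (s' : Fin n → ℝ) :
    sojourns u (i.insertNth t s') (Fin.last (n + 1)) = sojourns (u - t) s' (Fin.last n) := by
  rw [sojourns_insertNth, ← Fin.succAbove_ne_last_last (Fin.castSucc_lt_last i).ne,
    Fin.insertNth_apply_succAbove]

/-- The inserted sojourn of a peeled configuration is the inserted duration. [folklore] -/
theorem sojourns_insertNth_same {n : ℕ} (i : Fin (n + 1)) (t u : ℝ) (s' : Fin n → ℝ) :
    sojourns u (i.insertNth t s') (Fin.castSucc i) = t := by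
  rw [sojourns_insertNth, Fin.insertNth_apply_same]

/-- The other sojourns of a peeled configuration are those of the rest. [folklore] -/
theorem sojourns_insertNth_succAbove {n : ℕ} (i : Fin (n + 1)) (t u : ℝ) (s' : Fin n → ℝ)
    (b : Fin (n + 1)) :
    sojourns u (i.insertNth t s') ((Fin.castSucc i).succAbove b) = sojourns (u - t) s' b := by
  rw [sojourns_insertNth, Fin.insertNth_apply_succAbove]

/-- **Peeling one coordinate** (Fubini on `ℝ^{n+1} ≃ ℝ × ℝⁿ` through coordinate `i`): for a
measurable `F ≥ 0`,
`∫_{Δ_{n+1}(u)} F ds = ∫_{t ∈ (0,u)} ∫_{Δ_n(u - t)} F(insertNth i t s') ds' dt`. [folklore] -/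
theorem lintegral_sojournSet_succ {n : ℕ} (i : Fin (n + 1)) (u : ℝ)
    {F : (Fin (n + 1) → ℝ) → ℝ≥0∞} (hF : Measurable F) :
    ∫⁻ s in sojournSet (n + 1) u, F s =
      ∫⁻ t in Ioo 0 u, ∫⁻ s' in sojournSet n (u - t), F (i.insertNth t s') := by
  set e := MeasurableEquiv.piFinSuccAbove (fun _ : Fin (n + 1) => ℝ) i with he
  have hmp : MeasurePreserving e.symm (volume : Measure (ℝ × (Fin n → ℝ))) volume :=
    (volume_preserving_piFinSuccAbove (fun _ : Fin (n + 1) => ℝ) i).symm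
  have hsymm : ∀ p : ℝ × (Fin n → ℝ), e.symm p = i.insertNth p.1 p.2 := fun p => rfl
  rw [← lintegral_indicator (measurableSet_sojournSet _ _),
    ← hmp.lintegral_comp_emb e.symm.measurableEmbedding]
  have hmeas : Measurable fun p : ℝ × (Fin n → ℝ) => (sojournSet (n + 1) u).indicator F (e.symm p) :=
    (hF.indicator (measurableSet_sojournSet _ _)).comp e.symm.measurable
  rw [Measure.volume_eq_prod, lintegral_prod _ hmeas.aemeasurable,
    ← lintegral_indicator measurableSet_Ioo]
  refine lintegral_congr fun t => ?_
  simp only [hsymm]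
  by_cases ht : t ∈ Ioo (0 : ℝ) u
  · rw [indicator_of_mem ht, ← lintegral_indicator (measurableSet_sojournSet _ _)]
    refine lintegral_congr fun s' => ?_
    by_cases hs' : s' ∈ sojournSet n (u - t)
    · rw [indicator_of_mem hs', indicator_of_mem ((insertNth_mem_sojournSet_iff i t u s').2 ⟨ht, hs'⟩)]
    · rw [indicator_of_notMem hs', indicator_of_notMem]
      exact fun h => hs' ((insertNth_mem_sojournSet_iff i t u s').1 h).2
  · rw [indicator_of_notMem ht]
    refine (lintegral_eq_zero_iff' (hmeas.comp measurable_prodMk_left).aemeasurable).2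
      (Eventually.of_forall fun s' => ?_)
    simp only [Function.comp, hsymm, Pi.zero_apply]
    rw [indicator_of_notMem]
    exact fun h => ht ((insertNth_mem_sojournSet_iff i t u s').1 h).1

/-! ### One-dimensional Beta integrals -/

/-- `∫_0^u (u-t)^m dt = u^{m+1}/(m+1)`. [folklore] -/
theorem integral_sub_pow (u : ℝ) (m : ℕ) :
    ∫ t in (0 : ℝ)..u, (u - t) ^ m = u ^ (m + 1) / (m + 1) := by
  rw [intervalIntegral.integral_comp_sub_left (fun x => x ^ m) u]
  simp [integral_pow]

/-- `∫_0^u t (u-t)^m dt = u^{m+2}/((m+1)(m+2))`. [folklore] -/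
theorem integral_mul_sub_pow (u : ℝ) (m : ℕ) :
    ∫ t in (0 : ℝ)..u, t * (u - t) ^ m = u ^ (m + 2) / ((m + 1) * (m + 2)) := by
  have h : ∀ t : ℝ, t * (u - t) ^ m = u * (u - t) ^ m - (u - t) ^ (m + 1) := fun t => by ring
  simp_rw [h]
  rw [intervalIntegral.integral_sub, intervalIntegral.integral_const_mul, integral_sub_pow,
    integral_sub_pow]
  · push_cast
    field_simp
    ring
  · exact (continuous_const.mul ((continuous_const.sub continuous_id).pow m)).intervalIntegrable _ _
  · exact ((continuous_const.sub continuous_id).pow (m + 1)).intervalIntegrable _ _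

/-- `∫_0^u t² (u-t)^m dt = 2u^{m+3}/((m+1)(m+2)(m+3))`. [folklore] -/
theorem integral_sq_mul_sub_pow (u : ℝ) (m : ℕ) :
    ∫ t in (0 : ℝ)..u, t ^ 2 * (u - t) ^ m = 2 * u ^ (m + 3) / ((m + 1) * (m + 2) * (m + 3)) := by
  have h : ∀ t : ℝ, t ^ 2 * (u - t) ^ m =
      u ^ 2 * (u - t) ^ m - 2 * u * (u - t) ^ (m + 1) + (u - t) ^ (m + 2) := fun t => by ring
  simp_rw [h]
  have hc : ∀ k : ℕ, Continuous fun t : ℝ => (u - t) ^ k := fun k =>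
    (continuous_const.sub continuous_id).pow k
  rw [intervalIntegral.integral_add, intervalIntegral.integral_sub, intervalIntegral.integral_const_mul,
    intervalIntegral.integral_const_mul, integral_sub_pow, integral_sub_pow, integral_sub_pow]
  · push_cast
    field_simp
    ring
  · exact (continuous_const.mul (hc m)).intervalIntegrable _ _
  · exact (continuous_const.mul (hc (m + 1))).intervalIntegrable _ _
  · exact ((continuous_const.mul (hc m)).sub (continuous_const.mul (hc (m + 1)))).intervalIntegrable _ _
  · exact (hc (m + 2)).intervalIntegrable _ _

/-- Converting a lower integral over `(0,u)` of a continuous nonnegative function into an interval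
integral. [folklore] -/
theorem lintegral_Ioo_eq_ofReal_integral {u : ℝ} (hu : 0 ≤ u) {f : ℝ → ℝ} (hf : Continuous f)
    (hnn : ∀ t ∈ Ioo 0 u, 0 ≤ f t) :
    ∫⁻ t in Ioo 0 u, ENNReal.ofReal (f t) = ENNReal.ofReal (∫ t in (0 : ℝ)..u, f t) := by
  rw [intervalIntegral.integral_of_le hu, integral_Ioc_eq_integral_Ioo,
    ofReal_integral_eq_lintegral_ofReal]
  · exact hf.integrableOn_Icc.mono_set Ioo_subset_Icc_self
  · exact (ae_restrict_iff' measurableSet_Ioo).2 (Eventually.of_forall hnn)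

/-- Factorial bookkeeping: `u^{m+1}/(m+1)/m! = u^{m+1}/(m+1)!`. [folklore] -/
theorem pow_div_succ_div_factorial (u : ℝ) (m : ℕ) :
    u ^ (m + 1) / (m + 1) / m ! = u ^ (m + 1) / (m + 1)! := by
  rw [Nat.factorial_succ, Nat.cast_mul, div_div, mul_comm]
  push_cast
  ring

/-! ### Volume of the simplex -/

/-- **Volume of the simplex** (`volume_sojournSet` of the `…Proofs` file, positive-time form):
`|Δ_n(u)| = uⁿ/n!` for `u > 0`. [folklore] -/
theorem volume_sojournSet_of_pos (n : ℕ) {u : ℝ} (hu : 0 < u) :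
    volume (sojournSet n u) = ENNReal.ofReal (u ^ n / n !) := by
  rw [volume_sojournSet, if_pos hu]

/-- The simplex has finite volume. [folklore] -/
theorem volume_sojournSet_lt_top (n : ℕ) (u : ℝ) : volume (sojournSet n u) < ∞ := by
  rw [volume_sojournSet]
  split_ifs
  · exact ENNReal.ofReal_lt_top
  · exact ENNReal.zero_lt_top

/-! ### First moments of the sojourns -/

/-- **First moments**: `∫_{Δ_n(u)} σ_a ds = u^{n+1}/(n+1)!` for every sojourn index `a ≤ n`
(the sojourns are exchangeable under the uniform distribution on the simplex). [folklore] -/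
theorem lintegral_sojourns : ∀ (n : ℕ) {u : ℝ}, 0 < u → ∀ a : Fin (n + 1),
    ∫⁻ s in sojournSet n u, ENNReal.ofReal (sojourns u s a) = ENNReal.ofReal (u ^ (n + 1) / (n + 1)!)
  | 0, u, hu, a => by
    have ha : a = Fin.last 0 := Fin.ext (by have h := a.isLt; simp only [Fin.val_last]; omega)
    rw [ha, sojournSet_zero_of_pos hu, Measure.restrict_univ]
    simp only [sojourns_last, Finset.univ_eq_empty, Finset.sum_empty, sub_zero]
    rw [lintegral_const, volume_pi, Measure.pi_empty_univ]
    simp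
  | n + 1, u, hu, a => by
    induction a using Fin.lastCases with
    | last =>
      rw [lintegral_sojournSet_succ 0 u (by fun_prop)]
      have h : ∀ t ∈ Ioo (0 : ℝ) u,
          ∫⁻ s' in sojournSet n (u - t), ENNReal.ofReal (sojourns u (Fin.insertNth 0 t s') (Fin.last _)) =
            ENNReal.ofReal ((u - t) ^ (n + 1) / (n + 1)!) := fun t ht => by
        simp_rw [sojourns_insertNth_last]
        exact lintegral_sojourns n (by linarith [ht.2]) (Fin.last n)
      rw [setLIntegral_congr_fun measurableSet_Ioo h,
        lintegral_Ioo_eq_ofReal_integral hu.le (by fun_prop) fun t ht => by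
          have : 0 ≤ u - t := by linarith [ht.2]
          positivity]
      congr 1
      rw [intervalIntegral.integral_div, integral_sub_pow, pow_div_succ_div_factorial]
    | cast i =>
      rw [lintegral_sojournSet_succ i u (by fun_prop)]
      have h : ∀ t ∈ Ioo (0 : ℝ) u,
          ∫⁻ s' in sojournSet n (u - t), ENNReal.ofReal (sojourns u (i.insertNth t s') (Fin.castSucc i)) =
            ENNReal.ofReal (t * ((u - t) ^ n / n !)) := fun t ht => by
        simp_rw [sojourns_insertNth_same]
        rw [setLIntegral_const, volume_sojournSet_of_pos n (by linarith [ht.2]),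
          ENNReal.ofReal_mul ht.1.le]
      rw [setLIntegral_congr_fun measurableSet_Ioo h,
        lintegral_Ioo_eq_ofReal_integral hu.le (by fun_prop) fun t ht => by
          have : 0 ≤ u - t := by linarith [ht.2]
          have : 0 ≤ t := ht.1.le
          positivity]
      congr 1
      have hr : ∀ t : ℝ, t * ((u - t) ^ n / n !) = t * (u - t) ^ n / n ! := fun t => by ring
      simp_rw [hr]
      rw [intervalIntegral.integral_div, integral_mul_sub_pow]
      simp only [Nat.factorial_succ]
      push_cast
      field_simp
      ring

/-! ### Second moments of the sojourns -/

/-- Second moments with the first index an inner sojourn (peeling that coordinate). [folklore] -/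
theorem lintegral_sojourns_castSucc_mul {n : ℕ} {u : ℝ} (hu : 0 < u) (i : Fin (n + 1)) (b : Fin (n + 2))
    (ih : ∀ {w : ℝ}, 0 < w → ∀ a : Fin (n + 1),
      ∫⁻ s in sojournSet n w, ENNReal.ofReal (sojourns w s a) = ENNReal.ofReal (w ^ (n + 1) / (n + 1)!)) :
    ∫⁻ s in sojournSet (n + 1) u, ENNReal.ofReal (sojourns u s (Fin.castSucc i) * sojourns u s b) =
      ENNReal.ofReal ((if Fin.castSucc i = b then 2 else 1) * u ^ (n + 3) / (n + 3)!) := by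
  rw [lintegral_sojournSet_succ i u (by fun_prop)]
  by_cases hb : Fin.castSucc i = b
  · subst hb
    rw [if_pos rfl]
    have h : ∀ t ∈ Ioo (0 : ℝ) u,
        ∫⁻ s' in sojournSet n (u - t), ENNReal.ofReal
          (sojourns u (i.insertNth t s') (Fin.castSucc i) * sojourns u (i.insertNth t s') (Fin.castSucc i)) =
          ENNReal.ofReal (t ^ 2 * ((u - t) ^ n / n !)) := fun t ht => by
      simp_rw [sojourns_insertNth_same]
      rw [setLIntegral_const, volume_sojournSet_of_pos n (by linarith [ht.2]), ← sq,
        ENNReal.ofReal_mul (sq_nonneg t)]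
    rw [setLIntegral_congr_fun measurableSet_Ioo h,
      lintegral_Ioo_eq_ofReal_integral hu.le (by fun_prop) fun t ht => by
        have : 0 ≤ u - t := by linarith [ht.2]
        positivity]
    congr 1
    have hr : ∀ t : ℝ, t ^ 2 * ((u - t) ^ n / n !) = t ^ 2 * (u - t) ^ n / n ! := fun t => by ring
    simp_rw [hr]
    rw [intervalIntegral.integral_div, integral_sq_mul_sub_pow]
    simp only [Nat.factorial_succ]
    push_cast
    field_simp
    ring
  · rw [if_neg hb]
    obtain ⟨b', rfl⟩ := Fin.exists_succAbove_eq (Ne.symm hb)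
    have h : ∀ t ∈ Ioo (0 : ℝ) u,
        ∫⁻ s' in sojournSet n (u - t), ENNReal.ofReal
          (sojourns u (i.insertNth t s') (Fin.castSucc i) *
            sojourns u (i.insertNth t s') ((Fin.castSucc i).succAbove b')) =
          ENNReal.ofReal (t * ((u - t) ^ (n + 1) / (n + 1)!)) := fun t ht => by
      simp_rw [sojourns_insertNth_same, sojourns_insertNth_succAbove]
      have hut : 0 < u - t := by linarith [ht.2]
      simp_rw [ENNReal.ofReal_mul ht.1.le]
      rw [lintegral_const_mul _ ((continuous_sojourns _ _ _).measurable.ennreal_ofReal), ih hut b']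
    rw [setLIntegral_congr_fun measurableSet_Ioo h,
      lintegral_Ioo_eq_ofReal_integral hu.le (by fun_prop) fun t ht => by
        have : 0 ≤ u - t := by linarith [ht.2]
        have : 0 ≤ t := ht.1.le
        positivity]
    congr 1
    have hr : ∀ t : ℝ, t * ((u - t) ^ (n + 1) / (n + 1)!) = t * (u - t) ^ (n + 1) / (n + 1)! :=
      fun t => by ring
    simp_rw [hr]
    rw [intervalIntegral.integral_div, integral_mul_sub_pow]
    simp only [Nat.factorial_succ]
    push_cast
    field_simp
    ring

/-- **Second moments**: `∫_{Δ_n(u)} σ_a σ_b ds = (1 + [a = b]) u^{n+2}/(n+2)!` for all sojourn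
indices `a, b ≤ n` (including the terminal sojourn). [folklore] -/
theorem lintegral_sojourns_mul_sojourns : ∀ (n : ℕ) {u : ℝ}, 0 < u → ∀ a b : Fin (n + 1),
    ∫⁻ s in sojournSet n u, ENNReal.ofReal (sojourns u s a * sojourns u s b) =
      ENNReal.ofReal ((if a = b then 2 else 1) * u ^ (n + 2) / (n + 2)!)
  | 0, u, hu, a, b => by
    have ha : a = Fin.last 0 := Fin.ext (by have h := a.isLt; simp only [Fin.val_last]; omega)
    have hb : b = Fin.last 0 := Fin.ext (by have h := b.isLt; simp only [Fin.val_last]; omega)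
    rw [ha, hb, if_pos rfl, sojournSet_zero_of_pos hu, Measure.restrict_univ]
    simp only [sojourns_last, Finset.univ_eq_empty, Finset.sum_empty, sub_zero]
    rw [lintegral_const, volume_pi, Measure.pi_empty_univ, mul_one]
    congr 1
    simp [Nat.factorial]
    ring
  | n + 1, u, hu, a, b => by
    induction a using Fin.lastCases with
    | cast i => exact lintegral_sojourns_castSucc_mul hu i b fun hw => lintegral_sojourns n hw
    | last =>
      induction b using Fin.lastCases with
      | cast j =>
        simp_rw [mul_comm (sojourns u _ (Fin.last (n + 1)))]
        rw [lintegral_sojourns_castSucc_mul hu j (Fin.last (n + 1)) fun hw => lintegral_sojourns n hw,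
          if_neg (Fin.castSucc_lt_last j).ne, if_neg (Fin.castSucc_lt_last j).ne']
      | last =>
        rw [if_pos rfl, lintegral_sojournSet_succ 0 u (by fun_prop)]
        have h : ∀ t ∈ Ioo (0 : ℝ) u,
            ∫⁻ s' in sojournSet n (u - t), ENNReal.ofReal
              (sojourns u (Fin.insertNth 0 t s') (Fin.last _) * sojourns u (Fin.insertNth 0 t s') (Fin.last _)) =
              ENNReal.ofReal (2 * (u - t) ^ (n + 2) / (n + 2)!) := fun t ht => by
          simp_rw [sojourns_insertNth_last]
          rw [lintegral_sojourns_mul_sojourns n (by linarith [ht.2]) (Fin.last n) (Fin.last n), if_pos rfl]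
        rw [setLIntegral_congr_fun measurableSet_Ioo h,
          lintegral_Ioo_eq_ofReal_integral hu.le (by fun_prop) fun t ht => by
            have : 0 ≤ u - t := by linarith [ht.2]
            positivity]
        congr 1
        have hr : ∀ t : ℝ, 2 * (u - t) ^ (n + 2) / (n + 2)! = (2 / (n + 2)!) * (u - t) ^ (n + 2) :=
          fun t => by ring
        simp_rw [hr]
        rw [intervalIntegral.integral_const_mul, integral_sub_pow]
        simp only [Nat.factorial_succ]
        push_cast
        field_simp

/-! ### Integrating over the total time: `(T, s) ↦ sojourns T s` is measure preserving -/

/-- `sojourns T s` is `Fin.snoc`. [folklore] -/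
theorem sojourns_eq_snoc (T : ℝ) {k : ℕ} (s : Fin k → ℝ) : sojourns T s = Fin.snoc s (T - ∑ i, s i) := rfl

/-- The sojourn vector lies in the open orthant iff the durations are admissible. [folklore] -/
theorem sojourns_mem_pi_Ioi_iff {k : ℕ} (T : ℝ) (s : Fin k → ℝ) :
    sojourns T s ∈ Set.pi univ (fun _ => Ioi (0 : ℝ)) ↔ s ∈ sojournSet k T := by
  simp only [Set.mem_pi, mem_univ, mem_Ioi, forall_true_left, mem_sojournSet]
  constructor
  · intro h
    refine ⟨fun i => by simpa using h i.castSucc, ?_⟩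
    have := h (Fin.last k)
    rw [sojourns_last] at this
    linarith
  · intro h a
    exact sojourns_pos h a

/-- `(T, s) ↦ sojourns T s` is continuous. [folklore] -/
@[fun_prop]
theorem continuous_sojourns_uncurry (k : ℕ) :
    Continuous fun p : ℝ × (Fin k → ℝ) => sojourns p.1 p.2 := by
  refine continuous_pi fun a => ?_
  induction a using Fin.lastCases with
  | last =>
    simp only [sojourns_last]
    exact continuous_fst.sub ((continuous_finsetSum _ fun i _ => continuous_apply i).comp continuous_snd)
  | cast i =>
    simp only [sojourns_castSucc]
    exact (continuous_apply i).comp continuous_snd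

/-- **Integrating out the total time.** For measurable `H ≥ 0` on `ℝ^{n+1}`,
`∫_{T>0} ∫_{Δ_n(T)} H(sojourns T s) ds dT = ∫_{(0,∞)^{n+1}} H(σ) dσ`: the affine bijection
`(T, s) ↦ (s, T - Σ s)` has unit Jacobian. [folklore] -/
theorem lintegral_Ioi_lintegral_sojournSet {n : ℕ} {H : (Fin (n + 1) → ℝ) → ℝ≥0∞}
    (hH : Measurable H) :
    ∫⁻ T in Ioi 0, ∫⁻ s in sojournSet n T, H (sojourns T s) =
      ∫⁻ σ in Set.pi univ (fun _ => Ioi (0 : ℝ)), H σ := by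
  have hpi : MeasurableSet (Set.pi univ fun _ : Fin (n + 1) => Ioi (0 : ℝ)) :=
    MeasurableSet.univ_pi fun _ => measurableSet_Ioi
  set H' : (Fin (n + 1) → ℝ) → ℝ≥0∞ := (Set.pi univ fun _ => Ioi (0 : ℝ)).indicator H with hH'
  have hH'm : Measurable H' := hH.indicator hpi
  -- Step 1: `ℝ^{n+1} ≃ ℝ × ℝⁿ` through the last coordinate.
  set e := MeasurableEquiv.piFinSuccAbove (fun _ : Fin (n + 1) => ℝ) (Fin.last n) with he
  have hmp : MeasurePreserving e.symm (volume : Measure (ℝ × (Fin n → ℝ))) volume :=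
    (volume_preserving_piFinSuccAbove (fun _ : Fin (n + 1) => ℝ) (Fin.last n)).symm
  have hsymm : ∀ p : ℝ × (Fin n → ℝ), e.symm p = Fin.snoc p.2 p.1 := fun p =>
    (Fin.insertNth_last' p.1 p.2)
  rw [← lintegral_indicator hpi, ← hH', ← hmp.lintegral_comp_emb e.symm.measurableEmbedding,
    Measure.volume_eq_prod,
    lintegral_prod (fun a => H' (e.symm a)) (hH'm.comp e.symm.measurable).aemeasurable]
  simp only [hsymm]
  -- Step 2: swap, translate the time variable by `Σ s`, swap back.
  have hm2 : Measurable fun p : ℝ × (Fin n → ℝ) => H' (Fin.snoc p.2 p.1) := by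
    have : (fun p : ℝ × (Fin n → ℝ) => H' (Fin.snoc p.2 p.1)) = H' ∘ e.symm := by
      funext p; simp [hsymm]
    rw [this]
    exact hH'm.comp e.symm.measurable
  rw [lintegral_lintegral_swap hm2.aemeasurable]
  have hm3 : Measurable fun p : ℝ × (Fin n → ℝ) => H' (sojourns p.1 p.2) :=
    hH'm.comp (continuous_sojourns_uncurry n).measurable
  have hstep : ∀ s : Fin n → ℝ, ∫⁻ x, H' (Fin.snoc s x) = ∫⁻ T, H' (sojourns T s) := fun s => by
    rw [← lintegral_sub_right_eq_self (fun x => H' (Fin.snoc s x)) (∑ i, s i)]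
    rfl
  simp_rw [hstep]
  rw [← lintegral_lintegral_swap hm3.aemeasurable, ← lintegral_indicator measurableSet_Ioi]
  refine lintegral_congr fun T => ?_
  by_cases hT : T ∈ Ioi (0 : ℝ)
  · rw [indicator_of_mem hT, ← lintegral_indicator (measurableSet_sojournSet _ _)]
    refine lintegral_congr fun s => ?_
    simp only [hH']
    by_cases hs : s ∈ sojournSet n T
    · rw [indicator_of_mem hs, indicator_of_mem ((sojourns_mem_pi_Ioi_iff T s).2 hs)]
    · rw [indicator_of_notMem hs, indicator_of_notMem (fun h => hs ((sojourns_mem_pi_Ioi_iff T s).1 h))]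
  · rw [indicator_of_notMem hT]
    symm
    refine (lintegral_eq_zero_iff' (hm3.comp measurable_prodMk_left).aemeasurable).2
      (Eventually.of_forall fun s => ?_)
    simp only [Function.comp, Pi.zero_apply, hH']
    rw [indicator_of_notMem]
    intro h
    exact hT (pos_of_mem_sojournSet ((sojourns_mem_pi_Ioi_iff T s).1 h))

/-! ### Product integrands on `ℝ^m` -/

/-- **Fubini for a product integrand on `ℝ^m`**: `∫ Π_a f(σ_a) dσ = (∫ f)^m`. [folklore] -/
theorem lintegral_prod_eq_pow (f : ℝ → ℝ≥0∞) (hf : Measurable f) : ∀ m : ℕ,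
    ∫⁻ σ : Fin m → ℝ, ∏ a, f (σ a) = (∫⁻ x, f x) ^ m
  | 0 => by
    simp only [Finset.univ_eq_empty, Finset.prod_empty, pow_zero]
    rw [lintegral_const, volume_pi, Measure.pi_empty_univ, one_mul]
  | m + 1 => by
    set e := MeasurableEquiv.piFinSuccAbove (fun _ : Fin (m + 1) => ℝ) 0 with he
    have hmp : MeasurePreserving e.symm (volume : Measure (ℝ × (Fin m → ℝ))) volume :=
      (volume_preserving_piFinSuccAbove (fun _ : Fin (m + 1) => ℝ) 0).symm
    have hsymm : ∀ p : ℝ × (Fin m → ℝ), e.symm p = Fin.cons p.1 p.2 := fun p =>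
      Fin.insertNth_zero' p.1 p.2
    rw [← hmp.lintegral_comp_emb e.symm.measurableEmbedding]
    simp only [hsymm, Fin.prod_univ_succ, Fin.cons_zero, Fin.cons_succ]
    have hg : Measurable fun σ : Fin m → ℝ => ∏ a, f (σ a) :=
      Finset.measurable_prod _ fun a _ => hf.comp (measurable_pi_apply a)
    rw [Measure.volume_eq_prod,
      lintegral_prod_mul (f := f) (g := fun σ : Fin m → ℝ => ∏ a, f (σ a)) hf.aemeasurable
        hg.aemeasurable,
      lintegral_prod_eq_pow f hf m, pow_succ']

/-- The same over the open orthant: `∫_{(0,∞)^m} Π_a f(σ_a) dσ = (∫_{(0,∞)} f)^m`. [folklore] -/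
theorem setLIntegral_pi_Ioi_prod_eq_pow (f : ℝ → ℝ≥0∞) (hf : Measurable f) (m : ℕ) :
    ∫⁻ σ in Set.pi univ (fun _ => Ioi (0 : ℝ)), ∏ a : Fin m, f (σ a) = (∫⁻ x in Ioi 0, f x) ^ m := by
  have hpi : MeasurableSet (Set.pi univ fun _ : Fin m => Ioi (0 : ℝ)) :=
    MeasurableSet.univ_pi fun _ => measurableSet_Ioi
  rw [← lintegral_indicator hpi, ← lintegral_indicator measurableSet_Ioi,
    ← lintegral_prod_eq_pow _ (hf.indicator measurableSet_Ioi) m]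
  refine lintegral_congr fun σ => ?_
  by_cases hσ : σ ∈ Set.pi univ fun _ : Fin m => Ioi (0 : ℝ)
  · rw [indicator_of_mem hσ]
    refine Finset.prod_congr rfl fun a _ => ?_
    rw [indicator_of_mem (by simpa using hσ a (mem_univ a))]
  · rw [indicator_of_notMem hσ]
    simp only [Set.mem_pi, mem_univ, forall_true_left, not_forall] at hσ
    obtain ⟨a, ha⟩ := hσ
    exact (Finset.prod_eq_zero (Finset.mem_univ a) (indicator_of_notMem ha _)).symm

end Literature.Barriers.CriticalPhenomena.CTWSAW
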